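import Mathlib.Data.Real.Basic
import Mathlib.Algebra.Order.Field.Basic
import Mathlib.Tactic.Linarith
import Mathlib.Tactic.Positivity
import HarnessLib

/-!
# `NoHeavyLowerTail` (stmt-CriticalPhenomena-4575) — the POTENTIAL METHOD on finite weighted decision trees (bookkeeping type `DTree`)

Support file (prover prim-ineq-gen-8 gen 47; `--supports stmt-CriticalPhenomena-4575`; memo
run/shared/lean/prim/prim-ineq-gen-8/FINDING-gen47-POTENTIAL.md).  Pure real algebra and a finite-tree induction: no definitions of
mathematical objects beyond a bookkeeping tree, no named facts, no sorries.

SETTING (memo FINDING-gen46b-LAYERCAKE.md §2, FINDING-gen47 §1).  A decision tree explores the percolation configuration edge by edge;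
the node (= state) `s` is reached with probability `w_s`, queries an edge of weight `p_s`, and carries the reward
`r_s = p_s (1 − p_s) a_s² · 1[m̂_s ≤ m]` (small-piece variance) or any other per-state quantity.  The layer-cake inequality (LC-F) for the
tree `T` reads `Σ_s w_s r_s ≤ m · Σ_z ℓ_z p_z (1 − p_z)`.  The POTENTIAL METHOD (FINDING-gen47 §4): if a function `Φ` of the state satisfies
`Φ(s) ≥ r_s + p_s Φ(s¹) + (1 − p_s) Φ(s⁰)` at every node (`s¹, s⁰` the two children) and `Φ ≥ 0` at the leaves, then
`Σ_s w_s r_s ≤ Φ(root)`; dually a SUB-solution bounds the total from below (used for the big-piece variance `X_big`).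

THIS FILE proves [this work]: `DTree.total_le_pot` (a super-solution / potential dominates the expected total reward — with
`r_s = p_s q_s a_s² 1[m̂_s ≤ m]` and `Φ(root) ≤ m F` this is (LC-F) for the tree), its dual `DTree.pot_le_total` (a sub-solution is dominated;
used to certify big-piece variance from below), and `DTree.total_mono`.  `DTree` is a pure bookkeeping type (a finite binary tree whose nodes
carry a branch probability, a reward and a potential value); the one-step real algebra lives in `…APLVwPotential.lean`.
-/

noncomputable section

namespace Summit.CriticalPhenomena.PercolationContinuityZ3.Theorems

namespace APL

/-! ### The potential method on finite weighted binary (decision) trees -/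

/-- A finite binary decision tree for bookkeeping: a `leaf φ` carries a terminal potential value `φ`; a `node p r φ l rt` queries an edge of
weight `p`, earns the reward `r` (e.g. `p (1-p) a² · 1[small]`), carries the potential value `φ` of its state, and continues with `l` (edge
open, probability `p`) and `rt` (edge closed, probability `1 − p`). [this work] -/
inductive DTree : Type
  | leaf (φ : ℝ) : DTree
  | node (p r φ : ℝ) (l rt : DTree) : DTree

namespace DTree

/-- The potential value attached to the root of the (sub)tree. -/
def pot : DTree → ℝ
  | leaf φ => φ
  | node _ _ φ _ _ => φ

/-- The expected total reward `Σ_s w_s r_s` of the (sub)tree (weights = products of the branch probabilities). -/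
def total : DTree → ℝ
  | leaf _ => 0
  | node p r _ l rt => r + p * l.total + (1 - p) * rt.total

/-- SUPER-solution (potential): probabilities in `[0,1]`, `φ ≥ 0` at leaves, and `r + p φ(l) + (1-p) φ(rt) ≤ φ` at every node. -/
def superSol : DTree → Prop
  | leaf φ => 0 ≤ φ
  | node p r φ l rt => 0 ≤ p ∧ p ≤ 1 ∧ r + p * l.pot + (1 - p) * rt.pot ≤ φ ∧ l.superSol ∧ rt.superSol

/-- SUB-solution: probabilities in `[0,1]`, `φ ≤ 0` at leaves, and `φ ≤ r + p φ(l) + (1-p) φ(rt)` at every node. -/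
def subSol : DTree → Prop
  | leaf φ => φ ≤ 0
  | node p r φ l rt => 0 ≤ p ∧ p ≤ 1 ∧ φ ≤ r + p * l.pot + (1 - p) * rt.pot ∧ l.subSol ∧ rt.subSol

/-- **Potential method.**  A super-solution dominates the expected total reward: `Σ_s w_s r_s ≤ Φ(root)`.  With
`r_s = p_s q_s a_s² 1[m̂_s ≤ m]` and `Φ(root) ≤ m F` this is the layer-cake inequality (LC-F) for the tree. [this work] -/
theorem total_le_pot : ∀ t : DTree, t.superSol → t.total ≤ t.pot
  | leaf φ, h => by simpa [total, pot, superSol] using h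
  | node p r φ l rt, h => by
      rcases h with ⟨hp0, hp1, hstep, hl, hr⟩
      have ihl := total_le_pot l hl
      have ihr := total_le_pot rt hr
      have h1 : p * l.total ≤ p * l.pot := mul_le_mul_of_nonneg_left ihl hp0
      have h2 : (1 - p) * rt.total ≤ (1 - p) * rt.pot := mul_le_mul_of_nonneg_left ihr (by linarith)
      simp only [total, pot]
      linarith

/-- **Dual potential method.**  A sub-solution is dominated by the expected total reward: `Φ(root) ≤ Σ_s w_s r_s`
(used with `r_s = p_s q_s a_s² 1[m̂_s > m]` to certify big-piece variance from below). [this work] -/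
theorem pot_le_total : ∀ t : DTree, t.subSol → t.pot ≤ t.total
  | leaf φ, h => by simpa [total, pot, subSol] using h
  | node p r φ l rt, h => by
      rcases h with ⟨hp0, hp1, hstep, hl, hr⟩
      have ihl := pot_le_total l hl
      have ihr := pot_le_total rt hr
      have h1 : p * l.pot ≤ p * l.total := mul_le_mul_of_nonneg_left ihl hp0
      have h2 : (1 - p) * rt.pot ≤ (1 - p) * rt.total := mul_le_mul_of_nonneg_left ihr (by linarith)
      simp only [total, pot]
      linarith

/-- Pointwise order on rewards between two trees of the same shape with the same branch probabilities. [this work] -/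
inductive le_rewards : DTree → DTree → Prop
  | leaf (φ₁ φ₂ : ℝ) : le_rewards (leaf φ₁) (leaf φ₂)
  | node (p r₁ r₂ φ₁ φ₂ : ℝ) (l₁ l₂ rt₁ rt₂ : DTree) (hp0 : 0 ≤ p) (hp1 : p ≤ 1) (hr : r₁ ≤ r₂)
      (hl : le_rewards l₁ l₂) (hrt : le_rewards rt₁ rt₂) : le_rewards (node p r₁ φ₁ l₁ rt₁) (node p r₂ φ₂ l₂ rt₂)

/-- Monotonicity of the expected total reward in the rewards (same shape, same probabilities). [this work] -/
theorem total_mono : ∀ {t₁ t₂ : DTree}, le_rewards t₁ t₂ → t₁.total ≤ t₂.total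
  | _, _, le_rewards.leaf _ _ => by simp [total]
  | _, _, le_rewards.node p r₁ r₂ φ₁ φ₂ l₁ l₂ rt₁ rt₂ hp0 hp1 hr hl hrt => by
      have ihl := total_mono hl
      have ihr := total_mono hrt
      have h1 : p * l₁.total ≤ p * l₂.total := mul_le_mul_of_nonneg_left ihl hp0
      have h2 : (1 - p) * rt₁.total ≤ (1 - p) * rt₂.total := mul_le_mul_of_nonneg_left ihr (by linarith)
      simp only [total]
      linarith

end DTree

end APL

end Summit.CriticalPhenomena.PercolationContinuityZ3.Theorems

end
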